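/-
Speedrun cell sr-mbsolver — LEAN team (lit-4 gen-3), D-18 r72(c): lane-B transport, PRIMAL form, pure `lti(n)`, spin
statistics ("THEOREM B0" of `sr-mbsolver-lit-4/THEOREM-B.md`: the whole theorem-B pipeline except the MPS coarse-graining step).
HONEST FRAMING: first certified bounds; not a superconductivity verdict; every number certified or labelled float.

WHAT THIS GIVES. For a lane-B `relax = lti(m)` Heisenberg row the two readers (verify_a ∧ verify_b, certsdp-cert/0) certify
exactly FORMAT-ltisdp §2(d): `c·y ≥ E` for every `y` feasible for the problem `P` with the a-priori bounds — i.e. the FINITE statement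
  `∀ ρ (an m-site window density matrix: PSD, trace 1, LTI, Sᶻ-sectored, real, entries ≤ 1), E ≤ Re tr(J 𝐒₀·𝐒₁ ρ)`
over `Op (Fin m) (n+1)` (`m = m'+2`), written with the problem's literal data. `lti_primal_ringEnergy_ge` transports that statement
BY NAME to every ring: `E · L ≤ E₀(H_L)` for all `L ≥ m + 1`, and `lti_primal_energyDensity_ge` to the thermodynamic limit
`E ≤ heisenbergEnergyDensity n 1 J` (`J ≥ 0`). No dual object needs to be exported (contrast `Transport/LTIDualSpinChain.lean`).

PROOF (= FORMAT-ltisdp §2 (a)(b)(c); KSDN arXiv:2212.03014 §II.B). Take the tracial ground state `ω₀` of `H_L`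
(`Matrix.groundStateFunctional`; invariant under the ring translations, `groundStateFunctional_conj_of_commute`), its window density
matrix `ρ₀ = densityAlong ω₀ ι` (pub-mbboot-lit's `SpinPartialTrace.lean`: PSD, trace 1, and LTI by
`spinPartialTrace_succ_densityAlong_eq_of_invariant`), Sᶻ-sectored because `[H, Sᶻ_tot] = 0` (`commute_heisenberg_totalSpin_holds`) makes
`ω₀([Sᶻ_tot, ·]) = 0`; then `ρ = ½(ρ₀ + ρ₀ᵀ)` is REAL symmetric and still feasible (the exchange operator has real entries, proved
here from the spin matrices), entries `≤ 1` by the `2 × 2` principal minors, and `Re tr(J 𝐒₀·𝐒₁ ρ) = ω₀(J 𝐒_0·𝐒_1) = E₀(H_L)/L` by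
translation invariance (`sum_permOp_conj_spinDot`). [cite: KullEtAl2024, §II.B, §VI.B] [cite: Tasaki2020, §2.1, §2.4–2.5]
-/
import Summits.Ventures.CertifiedManyBodySolver.Transport.LTIPrimalPrelude
import Literature.MathematicalPhysics.QuantumLattice.HeisenbergEnergyDensity
import Literature.MathematicalPhysics.QuantumLattice.HeisenbergModelGlobalRotationProofs
import HarnessLib

noncomputable section

open Matrix Complex Filter Topology
open scoped ComplexOrder
open Literature.Probability.LatticeModels
open Literature.MathematicalPhysics.QuantumLattice
open Literature.MathematicalPhysics.QuantumManyBody.StateRelaxation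

namespace Summit.Ventures.CertifiedManyBodySolver.Transport

/-! ### The by-value node of a `relax = lti(m)` Heisenberg row and its transport -/

section Transport

/-! **The by-value node** is the unbundled statement
`∀ ρ, ρ ⪰ 0 → tr ρ = 1 → tr_L ρ = tr_R ρ → (Sᶻ-sector zeros) → (real entries) → (|ρ_{ts}| ≤ 1) → E ≤ Re tr((J 𝐒_0·𝐒_1) ρ)`
over the `m = m'+2`-site window variable `ρ : Op (Fin m) (n+1)` — the rows of FORMAT-ltisdp §1 verbatim; the objective
`Re tr((J 𝐒_0·𝐒_1) ρ)` is `tr(h ρ^{(2)})` of FORMAT-ltisdp §1 (bond `{0,1}` of the window). No named predicate and no auxiliary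
definition is introduced (propositions under `Summits/` are registered obligations only). [cite: KullEtAl2024, §II.B eq. (locTIn)] -/

variable {L : ℕ} [NeZero L]

omit [NeZero L] in
/-- The window map `{0, …, m-1} → ℤ/Lℤ`, `i ↦ i mod L`, is injective for `m ≤ L`. [folklore] -/
theorem window_injective (m : ℕ) (hm : m ≤ L) :
    Function.Injective (fun (i : Fin m) (_ : Fin 1) => ((i : ℕ) : ZMod L)) := by
  intro i j h
  have h' := congrFun h 0
  have hi : (i : ℕ) < L := lt_of_lt_of_le i.2 hm
  have hj : (j : ℕ) < L := lt_of_lt_of_le j.2 hm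
  have := (ZMod.natCast_eq_natCast_iff' (i : ℕ) (j : ℕ) L).1 h'
  rw [Nat.mod_eq_of_lt hi, Nat.mod_eq_of_lt hj] at this
  exact Fin.ext this

omit [NeZero L] in
/-- Site `0` of the window is the ring site `0 mod L`. [folklore] -/
theorem window_zero (m' : ℕ) :
    (fun _ : Fin 1 => ((((0 : Fin (m' + 2)) : ℕ) : ZMod L))) = Torus.proj L (0 : Site 1) := by
  funext j
  rw [Torus.proj_apply, Fin.val_zero, Nat.cast_zero, Pi.zero_apply, Int.cast_zero]

omit [NeZero L] in
/-- Site `1` of the window is the ring site `e₀ mod L`. [folklore] -/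
theorem window_one (m' : ℕ) :
    (fun _ : Fin 1 => ((((1 : Fin (m' + 2)) : ℕ) : ZMod L))) = Torus.proj L (unitVec 0 : Site 1) := by
  funext j
  have hj : j = 0 := Subsingleton.elim j 0
  subst hj
  rw [Torus.proj_apply, Fin.val_one, Nat.cast_one, unitVec, Pi.single_eq_same, Int.cast_one]

omit [NeZero L] in
/-- The unit translation shifts the window by one site. [folklore] -/
theorem torusAff_one_window_castSucc (m' : ℕ) (i : Fin (m' + 1)) :
    torusAff 1 (fun _ => (1 : ZMod L)) (fun _ : Fin 1 => (((i.castSucc : Fin (m' + 2)) : ℕ) : ZMod L)) =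
      fun _ : Fin 1 => (((i.succ : Fin (m' + 2)) : ℕ) : ZMod L) := by
  funext j
  rw [torusAff_one, Equiv.coe_addRight]
  show (((i.castSucc : Fin (m' + 2)) : ℕ) : ZMod L) + 1 = (((i.succ : Fin (m' + 2)) : ℕ) : ZMod L)
  rw [Fin.val_castSucc, Fin.val_succ, Nat.cast_succ]

/-- `|ℤ/Lℤ| = L` for the one-dimensional torus `Fin 1 → ℤ/Lℤ`. [folklore] -/
theorem card_torusSite_one : Fintype.card (TorusSite 1 L) = L := by
  rw [Fintype.card_fun, ZMod.card, Fintype.card_fin, pow_one]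

/-- **THEOREM B0 (ring form): the primal `lti(m)` statement bounds every ring.** If `E ≤ Re tr((J 𝐒_0·𝐒_1) ρ)` for every
feasible window variable `ρ` on `m = m'+2` sites (the unbundled node above), then `E · L ≤ E₀(H_L)` for every ring `ℤ/Lℤ` with
`L ≥ m + 1`, `H_L = J Σ 𝐒_x·𝐒_{x+1}`. [cite: KullEtAl2024, §II.B, §VI.B] [cite: Tasaki2020, §2.1, §2.4–2.5] -/
theorem lti_primal_ringEnergy_ge (n m' : ℕ) (J : ℝ) (hL : m' + 3 ≤ L) {E : ℝ}
    (hclaim : ∀ ρ : Op (Fin (m' + 2)) (n + 1), ρ.PosSemidef → ρ.trace = 1 →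
      spinPartialTrace (Fin.succEmb (m' + 1)) ρ = spinPartialTrace Fin.castSuccEmb ρ →
      (∀ t s : TensorIndex (Fin (m' + 2)) (n + 1), (∑ x, (t x : ℕ)) ≠ (∑ x, (s x : ℕ)) → ρ t s = 0) →
      (∀ t s : TensorIndex (Fin (m' + 2)) (n + 1), starRingEnd ℂ (ρ t s) = ρ t s) →
      (∀ t s : TensorIndex (Fin (m' + 2)) (n + 1), ‖ρ t s‖ ≤ 1) →
      E ≤ ((((J : ℂ) • spinDot n (0 : Fin (m' + 2)) 1) * ρ).trace).re) :
    E * L ≤ (heisenbergHamiltonian n (torusGraph 1 L) J).groundEnergy := by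
  classical
  -- the ring, its Hamiltonian, the tracial ground state
  set H : Op (TorusSite 1 L) (n + 1) := heisenbergHamiltonian n (torusGraph 1 L) J with hHdef
  have hH : H.IsHermitian := heisenbergHamiltonian_isHermitian n _ J
  haveI : Nonempty (TensorIndex (TorusSite 1 L) (n + 1)) := ⟨fun _ => 0⟩
  set ω₀ := H.groundStateFunctional with hω₀def
  have hpos : ∀ B : Op (TorusSite 1 L) (n + 1), 0 ≤ ω₀ (Bᴴ * B) := fun B => groundStateFunctional_nonneg H B
  have hone : ω₀ 1 = 1 := groundStateFunctional_one hH
  -- translation invariance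
  have hinv : ∀ (v : TorusSite 1 L) (A : Op (TorusSite 1 L) (n + 1)),
      ω₀ (permOp (torusAff 1 v) * A * (permOp (torusAff 1 v))ᴴ) = ω₀ A := fun v A =>
    groundStateFunctional_conj_of_commute hH (permOp_torusAff_mul_heisenbergHamiltonian n 1 v J)
      (conjTranspose_permOp_mul _) A
  -- the window and its marginal
  have hmL : m' + 2 ≤ L := by omega
  set ι : Fin (m' + 2) ↪ TorusSite 1 L := ⟨fun i _ => ((i : ℕ) : ZMod L), window_injective (m' + 2) hmL⟩ with hιdef
  have hιapp : ∀ i : Fin (m' + 2), ι i = fun _ : Fin 1 => ((i : ℕ) : ZMod L) := fun i => rfl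
  set ρ₀ : Op (Fin (m' + 2)) (n + 1) := densityAlong ω₀ ι with hρ₀def
  have hρ₀ : ρ₀.PosSemidef ∧ ρ₀.trace = 1 := posSemidef_and_trace_densityAlong ω₀ hpos hone ι
  -- LTI of the marginal: the unit translation shifts the window by one site
  set e : TorusSite 1 L ≃ TorusSite 1 L := torusAff 1 (fun _ => (1 : ZMod L)) with hedef
  have he : ∀ i : Fin (m' + 1), e (ι i.castSucc) = ι i.succ := by
    intro i
    rw [hedef, hιapp, hιapp]
    exact torusAff_one_window_castSucc m' i
  have hLTI₀ : spinPartialTrace (Fin.succEmb (m' + 1)) ρ₀ = spinPartialTrace Fin.castSuccEmb ρ₀ :=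
    spinPartialTrace_succ_densityAlong_eq_of_invariant ω₀ ι e he (hinv _)
  -- Sᶻ sectors of the marginal
  have hsec₀ : ∀ t s : TensorIndex (Fin (m' + 2)) (n + 1), (∑ x, (t x : ℕ)) ≠ (∑ x, (s x : ℕ)) → ρ₀ t s = 0 := by
    intro t s hts
    have hD : (totalSpin n 2 : Op (TorusSite 1 L) (n + 1)) * H = H * totalSpin n 2 :=
      ((commute_heisenberg_totalSpin_holds n (torusGraph 1 L)) J 2).symm.eq
    have hcomm : ω₀ (totalSpin n 2 * spinEmbed ι (Matrix.single s t (1 : ℂ)) -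
        spinEmbed ι (Matrix.single s t (1 : ℂ)) * totalSpin n 2) = 0 := by
      rw [map_sub, groundStateFunctional_mul_comm_of_commute hH hD, sub_self]
    rw [totalSpin_commutator_spinEmbed, totalSpin_two_eq_diagonal, diagonal_commutator_single, map_smul, map_smul,
      magnetisation_sub, smul_eq_mul, mul_eq_zero] at hcomm
    rcases hcomm with h | h
    · exfalso
      apply hts
      have h' := sub_eq_zero.1 h
      exact_mod_cast h'
    · rw [hρ₀def, densityAlong_apply]
      exact h
  -- the real symmetric point ρ = ½ (ρ₀ + ρ₀ᵀ)
  set ρ : Op (Fin (m' + 2)) (n + 1) := (1 / 2 : ℂ) • (ρ₀ + ρ₀ᵀ) with hρdef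
  have hherm₀ : ρ₀.IsHermitian := hρ₀.1.1
  have hρT : ρ₀ᵀ.PosSemidef := hρ₀.1.transpose
  have hρpsd : ρ.PosSemidef := by
    have hsum : (ρ₀ + ρ₀ᵀ).PosSemidef := hρ₀.1.add hρT
    have h2 : (0 : ℂ) ≤ 1 / 2 := by rw [Complex.le_def]; simp
    exact hsum.smul h2
  have hρtr : ρ.trace = 1 := by
    rw [hρdef, trace_smul, trace_add, trace_transpose, hρ₀.2, smul_eq_mul]
    norm_num
  have hρLTI : spinPartialTrace (Fin.succEmb (m' + 1)) ρ = spinPartialTrace Fin.castSuccEmb ρ := by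
    rw [hρdef, map_smul, map_smul, map_add, map_add, spinPartialTrace_succEmb_transpose,
      spinPartialTrace_castSuccEmb_transpose, hLTI₀]
  have hρsec : ∀ t s : TensorIndex (Fin (m' + 2)) (n + 1), (∑ x, (t x : ℕ)) ≠ (∑ x, (s x : ℕ)) → ρ t s = 0 := by
    intro t s hts
    rw [hρdef, Matrix.smul_apply, Matrix.add_apply, transpose_apply, hsec₀ t s hts, hsec₀ s t (Ne.symm hts), add_zero,
      smul_zero]
  have hρreal : ∀ t s : TensorIndex (Fin (m' + 2)) (n + 1), starRingEnd ℂ (ρ t s) = ρ t s := by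
    intro t s
    have h1 : starRingEnd ℂ (ρ₀ t s) = ρ₀ s t := by simpa [Complex.star_def] using hherm₀.apply s t
    have h2 : starRingEnd ℂ (ρ₀ s t) = ρ₀ t s := by simpa [Complex.star_def] using hherm₀.apply t s
    rw [hρdef, Matrix.smul_apply, Matrix.add_apply, transpose_apply, smul_eq_mul, map_mul, map_add, h1, h2,
      map_div₀, map_one, map_ofNat, add_comm]
  have hρbd : ∀ t s : TensorIndex (Fin (m' + 2)) (n + 1), ‖ρ t s‖ ≤ 1 :=
    norm_apply_le_one_of_posSemidef hρpsd hρtr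
  -- the objective at ρ equals E₀ / L
  set h : Op (Fin (m' + 2)) (n + 1) := (J : ℂ) • spinDot n (0 : Fin (m' + 2)) 1 with hhdef
  have hhT : hᵀ = h := by rw [hhdef, transpose_smul, spinDot_transpose]
  have hobj₀ : (h * ρ).trace = (h * ρ₀).trace := by
    have : (h * ρ₀ᵀ).trace = (h * ρ₀).trace := by
      rw [← trace_transpose, transpose_mul, transpose_transpose, hhT, trace_mul_comm]
    rw [hρdef, Matrix.mul_smul, Matrix.mul_add, trace_smul, trace_add, this, smul_eq_mul]
    ring
  have hbond : (h * ρ₀).trace = (J : ℂ) * ω₀ (spinDot n (Torus.proj L (0 : Site 1)) (Torus.proj L (unitVec 0 : Site 1))) := by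
    rw [hρ₀def, trace_mul_densityAlong, hhdef, map_smul, spinEmbed_spinDot, map_smul, smul_eq_mul, hιapp, hιapp,
      window_zero, window_one]
  have hL3 : 3 ≤ L := by omega
  have havg : (L : ℂ) * ω₀ (spinDot n (Torus.proj L (0 : Site 1)) (Torus.proj L (unitVec 0 : Site 1))) =
      ω₀ (heisenbergHamiltonian n (torusGraph 1 L) 1) := by
    rw [← sum_permOp_conj_spinDot n hL3, map_sum, Finset.sum_congr rfl fun v _ => hinv v _, Finset.sum_const,
      Finset.card_univ, card_torusSite_one, nsmul_eq_mul]
  have hHJ : H = (J : ℂ) • heisenbergHamiltonian n (torusGraph 1 L) 1 := by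
    rw [hHdef, heisenbergHamiltonian, heisenbergHamiltonian, Complex.ofReal_one, one_smul]
  have hE₀ : ω₀ H = (H.groundEnergy : ℂ) := groundStateFunctional_hamiltonian hH
  have hobjE : (L : ℂ) * (h * ρ).trace = (H.groundEnergy : ℂ) := by
    rw [hobj₀, hbond, ← mul_assoc, mul_comm (L : ℂ), mul_assoc, havg, ← smul_eq_mul, ← map_smul, ← hHJ, hE₀]
  -- apply the claim
  have hEle := hclaim ρ hρpsd hρtr hρLTI hρsec hρreal hρbd
  have hre : (L : ℝ) * ((h * ρ).trace).re = H.groundEnergy := by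
    have := congrArg Complex.re hobjE
    simpa [Complex.mul_re] using this
  have hLpos : (0 : ℝ) < L := by exact_mod_cast (show 0 < L by omega)
  calc E * L ≤ ((h * ρ).trace).re * L := by rw [hhdef]; gcongr
    _ = H.groundEnergy := by rw [mul_comm, hre]

omit [NeZero L] in
/-- **THEOREM B0 (thermodynamic limit).** Under the same primal `lti(m)` statement and `J ≥ 0`:
`E ≤ heisenbergEnergyDensity n 1 J`. [cite: KullEtAl2024, §II.B, §VI.B] [cite: Ruelle1969, §2.2] -/
theorem lti_primal_energyDensity_ge (n m' : ℕ) {J : ℝ} (hJ : 0 ≤ J) {E : ℝ}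
    (hclaim : ∀ ρ : Op (Fin (m' + 2)) (n + 1), ρ.PosSemidef → ρ.trace = 1 →
      spinPartialTrace (Fin.succEmb (m' + 1)) ρ = spinPartialTrace Fin.castSuccEmb ρ →
      (∀ t s : TensorIndex (Fin (m' + 2)) (n + 1), (∑ x, (t x : ℕ)) ≠ (∑ x, (s x : ℕ)) → ρ t s = 0) →
      (∀ t s : TensorIndex (Fin (m' + 2)) (n + 1), starRingEnd ℂ (ρ t s) = ρ t s) →
      (∀ t s : TensorIndex (Fin (m' + 2)) (n + 1), ‖ρ t s‖ ≤ 1) →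
      E ≤ ((((J : ℂ) • spinDot n (0 : Fin (m' + 2)) 1) * ρ).trace).re) :
    E ≤ heisenbergEnergyDensity n 1 J := by
  refine heisenbergEnergyDensity_ge_of_forall_ge n le_rfl hJ (m' + 3) fun L _ hL => ?_
  rw [pow_one, le_div_iff₀ (by exact_mod_cast (show 0 < L by omega))]
  exact lti_primal_ringEnergy_ge n m' J hL hclaim

end Transport

end Summit.Ventures.CertifiedManyBodySolver.Transport
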